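import Summits.ResolutionOfSingularities.ResolutionOfSingularities.Theorems.FrobeniusClosingSteerRsopMonomialStep
import Summits.ResolutionOfSingularities.ResolutionOfSingularities.Theorems.FrobeniusClosingSteerBlowupDerivation
import Summits.ResolutionOfSingularities.ResolutionOfSingularities.Theorems.FrobeniusClosingSteerQuadraticStepLemmas
import Summits.ResolutionOfSingularities.ResolutionOfSingularities.Theorems.FrobeniusClosingSteerCore4LowMultTwoCore
import Literature.AlgebraicGeometry.Resolution.PointBlowupOrderChart
import Mathlib.RingTheory.Valuation.LocalSubring
import HarnessLib

/-!
# Crux `Steer` (stmt-ResolutionOfSingularities-16345), chain W4.1, §σ2.26 (B2) «the cleaned Jacobian order never increases»: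
# the DERIVATION TRANSFORM LAW along one quadratic step and the NEAR-POINT ORDER BOUND in the `Subring` currency

OURS (campaign `res-hironaka`, rung L ★L-G4, slot W4.1; seat res-type-096 g9 on res-L0-w41-plan-1 RULING 66 (66b)
2026-08-27T09:59:23Z «(B2) PROVER = res-type-096»; res-L0-w41-strat-2 MEMO rev 12 §6⁗ (B2); replaces the role of no printed
item; NOT a statement of the manuscript under review [claim: Hironaka2017, status: under-review]; AI-produced, weaker than
expert review). Theses-free and definition-free support for the words-level reduction §σ2.26 of the frontier binder hS3.

## The step and the content

One step of a (stripped) radicand chain in the K♭ currency of `NoEternalStrippedRadicandChain`: `S ≤ S'` local subrings of a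
field `L`, `S` regular, `S'` a quadratic transform of `S` (`IsQuadraticTransform S S'`), an exceptional parameter `x ∈ S'`
with `𝔪_S · S' = (x)`, and a radicand law `f' · x ^ N = F` with `F ∈ S` and `N = p·e` a multiple of the characteristic
(`(N : L) = 0`). For a derivation `D ∈ Der_ℤ(S)` write `𝒥`-data `D F`; the CLEANING INVARIANCE `D (f − g^p) = D f`
(`derivation_sub_pow_char`) is why the Jacobian ideal `𝒥(f) = (D f)_D` of strat-2's memo does not see the cleaner.

* §1 `exists_along` — a quadratic transform of a Noetherian local subring is a quadratic transform ALONG a valuation ring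
  `O` dominating the target (Mathlib `LocalSubring.exists_le_valuationSubring` + tree `IsQuadraticTransform.along`), so that
  `S' = (S[𝔪/x₀])_{𝔪_O ∩ S[𝔪/x₀]}` for a generator `x₀ ∈ 𝔪_S` of minimal value, and `x₀ = u · x` for a unit `u ∈ S'`.
* §2 **TRANSFORM LAW** (any `p`, any dimension, NO isolatedness): for every `D ∈ Der_ℤ(S)` there are `D₁ ∈ Der_ℤ(S')` and a
  unit `u ∈ S'` with `u · D F = x ^ (N − 1) · D₁ f'` (`exists_derivation_unit_mul_eq_pow_mul`; `D₁` extends `x₀ · D`, res-L0-w41-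
  lead-1's `BlowupDerivation.exists_derivation_smul_localBlowupAlong`, and `N · x^(N−1) · D₁ x = 0`); if `D 𝔪 ⊆ 𝔪` then
  `D F = x ^ N · D₁ f'` (`exists_derivation_eq_pow_mul_of_log`, `D₁` extends `D` itself).
* §3 **NEAR-POINT ORDER BOUND** (Cossart–Piltant 2008 (11)/(a), tree `exists_weakTransform_chart_not_mem_pow`, transported
  along the chart isomorphism `θ_L : (S[𝔪t])_{(x₀t), N} ≅ S'` of `FrobeniusClosingSteerRsopMonomialStep`): for
  `h ∈ 𝔪^ν ∖ 𝔪^(ν+1)` the weak transform `h / x₀ ^ ν` lies in `S'` and NOT in `𝔪_{S'}^(ν+1)`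
  (`exists_div_pow_not_mem_pow_succ`).
* §4 **(B2) STEP THEOREM** (`exists_derivation_apply_not_mem_pow_succ`): if some `D ∈ Der_ℤ(S)` has
  `D F ∈ 𝔪^ν ∖ 𝔪^(ν+1)` and EITHER `N = ν + 1` (full strip at the Jacobian order) OR `N = ν` and `D` is `𝔪`-logarithmic, then
  some `D₁ ∈ Der_ℤ(S')` has `D₁ f' ∉ 𝔪_{S'}^(ν+1)`: the Jacobian order does not increase, `δ_{m+1} ≤ δ_m`.

Honest scope (posted to strat-2 / plan-1 2026-08-27T10:24Z): `δ := ord 𝒥` equals the optimal cleaned order minus one only for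
PERFECT residue fields; in general `δ ∈ {d′ − 1, d′}` when `Der_ℤ(S)` has a basis adapted to `𝔪`, and the two cases are exactly
the two mechanisms of §4. Nothing here is attributed to the manuscript under review.

[cite: CossartPiltant2008, proof of Prop. 4.2, (11) and (a)] [cite: Cutkosky2014, §2.1–2.2] [cite: Matsumura1987, §25] [folklore]
-/

noncomputable section

-- `Summit.<S>.<S>.…` duplicates the summit name by design (single-problem summit).
set_option linter.dupNamespace false

open IsLocalRing

namespace Summit.ResolutionOfSingularities.ResolutionOfSingularities.Theorems.SwitchingDichotomy

open Literature.AlgebraicGeometry.Resolution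

namespace CleanedOrderMonotone

universe u

variable {K : Type} [Field K]

/-! ## §0 Cleaning invariance of the Jacobian data -/

/-- **Cleaning invariance**: in characteristic `p` (`(p : S) = 0`) every `ℤ`-derivation kills `p`-th powers, so
`D (f − g ^ p) = D f` — the Jacobian ideal `(D f)_D` does not see the cleaner `g`. [folklore] -/
theorem derivation_sub_pow_char {S : Type*} [CommRing S] (p : ℕ) (hp : (p : S) = 0) (D : Derivation ℤ S S)
    (f g : S) : D (f - g ^ p) = D f := by
  rw [map_sub, D.leibniz_pow, nsmul_eq_mul, hp, zero_mul, sub_zero]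

/-! ## §1 A quadratic transform is a quadratic transform along a valuation ring dominating the target -/

/-- **Every quadratic transform of a Noetherian local subring is a quadratic transform ALONG some valuation ring** `O` of
`K` dominating the target (Chevalley: Mathlib `LocalSubring.exists_le_valuationSubring`; then the tree's
`IsQuadraticTransform.along`). [cite: Cutkosky2014, §2.2] [folklore] -/
theorem exists_along (S S' : Subring K) [IsLocalRing S] [IsNoetherianRing S] [IsLocalRing S']
    (h : IsQuadraticTransform S S') :
    ∃ O : ValuationSubring K, IsQuadraticTransformAlong O S S' ∧ SubringDominates S O.toSubring ∧
      SubringDominates S' O.toSubring := by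
  obtain ⟨O, hO⟩ := (LocalSubring.mk S').exists_le_valuationSubring
  haveI : IsLocalRing O.toSubring := inferInstanceAs (IsLocalRing O)
  have hS'O : SubringDominates S' O.toSubring := (subringDominates_iff S' O.toSubring).mpr hO
  exact ⟨O, h.along ⟨inferInstance, IsNoetherian.noetherian _⟩ hS'O, h.dominates.trans hS'O, hS'O⟩

/-- **The exceptional parameter is well defined up to a unit.** If `S' = (S[𝔪/x₀])_{𝔪_O ∩ S[𝔪/x₀]}` with `x₀ ∈ 𝔪_S`
non-zero and `x ∈ S'` generates `𝔪_S · S'`, then `x₀ = u · x` for a unit `u` of `S'` (both generate the same principal ideal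
of the domain `S'`: `y = x₀ · (y/x₀)` with `y/x₀ ∈ S[𝔪/x₀] ⊆ S'` for `y ∈ 𝔪_S`). [cite: Cutkosky2014, §2.1] [folklore] -/
theorem exists_isUnit_eq_mul {O : ValuationSubring K} {S S' : Subring K} [IsLocalRing S] [IsLocalRing S']
    (hle : S ≤ S') {x₀ : S} (hx₀ : x₀ ∈ maximalIdeal S) (hx₀0 : (x₀ : K) ≠ 0)
    (hS' : S' = locAtCentre (blowupRing S (x₀ : K)) O) (x : S')
    (hspan : Ideal.span ((Subring.inclusion hle) '' (maximalIdeal S : Set S)) = Ideal.span {x}) :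
    ∃ u : S', IsUnit u ∧ (Subring.inclusion hle x₀ : S') = u * x := by
  classical
  -- `𝔪_S · S' ⊆ (x₀)`
  have hA : Ideal.span ((Subring.inclusion hle) '' (maximalIdeal S : Set S)) ≤
      Ideal.span {Subring.inclusion hle x₀} := by
    rw [Ideal.span_le]
    rintro _ ⟨y, hy, rfl⟩
    have hdiv : (y : K) / (x₀ : K) ∈ S' := hS' ▸ le_locAtCentre _ O (div_mem_blowupRing (x₀ : K) hy)
    refine Ideal.mem_span_singleton'.mpr ⟨⟨(y : K) / (x₀ : K), hdiv⟩, Subtype.ext ?_⟩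
    change (y : K) / (x₀ : K) * (x₀ : K) = (y : K)
    exact div_mul_cancel₀ _ hx₀0
  -- `(x₀) = (x)`
  have hB : (Subring.inclusion hle x₀ : S') ∈ Ideal.span {x} := by
    rw [← hspan]
    exact Ideal.subset_span ⟨x₀, hx₀, rfl⟩
  have heq : Ideal.span {Subring.inclusion hle x₀} = Ideal.span {x} :=
    le_antisymm ((Ideal.span_singleton_le_iff_mem _).mpr hB) (hspan ▸ hA)
  obtain ⟨u, hu⟩ := Ideal.span_singleton_eq_span_singleton.mp heq
  refine ⟨↑u⁻¹, Units.isUnit _, ?_⟩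
  rw [← hu, mul_comm (↑u⁻¹ : S'), mul_assoc, Units.mul_inv, mul_one]

/-! ## §2 The derivation transform law along one quadratic step -/

/-- Leibniz for a power whose exponent vanishes in the ring: `D (a * x ^ N) = x ^ N * D a` when `(N : A) = 0`. [folklore] -/
theorem derivation_mul_pow_of_cast_eq_zero {A : Type*} [CommRing A] (D : Derivation ℤ A A) (a x : A) (N : ℕ)
    (hN : (N : A) = 0) : D (a * x ^ N) = x ^ N * D a := by
  rw [D.leibniz, D.leibniz_pow, nsmul_eq_mul, hN, zero_mul, smul_zero, zero_add, smul_eq_mul]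

/-- **TRANSFORM LAW (a), along `O`.** Let `S'` be the quadratic transform of the regular local subring `S` along `O`,
`x ∈ S'` a generator of `𝔪_S · S'`, and `f' · x ^ N = F` with `F ∈ S` and `(N : S') = 0`, `N ≥ 1`. Then for every
`D ∈ Der_ℤ(S)` there are `D₁ ∈ Der_ℤ(S')` and a unit `u ∈ S'` with `u · D F = x ^ (N − 1) · D₁ f'`: `D₁` is res-L0-w41-lead-1's
extension of `x₀ · D` to the local blowing up (`BlowupDerivation.exists_derivation_smul_localBlowupAlong`), `x₀ = u · x`, and
`D₁ (f' · x ^ N) = x ^ N · D₁ f'` because `N · x ^ (N−1) · D₁ x = 0`. No isolatedness, any dimension, any `p ∣ N`. OURS. [folklore] -/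
theorem exists_derivation_unit_mul_eq_pow_mul_along {O : ValuationSubring K} {S S' : Subring K}
    [IsRegularLocalRing S] [IsLocalRing S'] (hA : IsQuadraticTransformAlong O S S')
    (hle : S ≤ S') (x : S')
    (hspan : Ideal.span ((Subring.inclusion hle) '' (maximalIdeal S : Set S)) = Ideal.span {x})
    (F : S) (f' : S') (N : ℕ) (hN1 : 1 ≤ N) (hN : (N : S') = 0)
    (hrel : f' * x ^ N = Subring.inclusion hle F) (D : Derivation ℤ S S) :
    ∃ (D₁ : Derivation ℤ S' S') (u : S'), IsUnit u ∧
      u * Subring.inclusion hle (D F) = x ^ (N - 1) * D₁ f' := by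
  obtain ⟨_, hLB⟩ := id hA
  obtain ⟨_, x₀, hx₀m, hx₀0, -, hS'⟩ := hA.exists_eq_locAtCentre
  have hx₀K : (x₀ : K) ≠ 0 := fun e => hx₀0 (Subtype.ext e)
  obtain ⟨u, hu, hux⟩ := exists_isUnit_eq_mul hle hx₀m hx₀K hS' x hspan
  obtain ⟨D₁, hD₁⟩ :=
    BlowupDerivation.exists_derivation_smul_localBlowupAlong O S S' (maximalIdeal S) hLB x₀ hx₀m D
  refine ⟨D₁, u, hu, ?_⟩
  have hDF : D₁ (Subring.inclusion hle F) = Subring.inclusion hle (x₀ * D F) := hD₁ F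
  have h1 : x ^ N * D₁ f' = u * x * Subring.inclusion hle (D F) := by
    rw [← derivation_mul_pow_of_cast_eq_zero D₁ f' x N hN, hrel, hDF, map_mul, hux]
  -- cancel one factor `x`
  have hx0 : x ≠ 0 := by
    intro h0
    apply hx₀0
    have : (Subring.inclusion hle x₀ : S') = 0 := by rw [hux, h0, mul_zero]
    exact Subring.inclusion_injective hle (by rw [this, map_zero])
  obtain ⟨M, rfl⟩ : ∃ M, N = M + 1 := ⟨N - 1, (Nat.sub_add_cancel hN1).symm⟩
  rw [Nat.add_sub_cancel]
  rw [pow_succ, mul_comm (x ^ M) x, mul_assoc, mul_comm u x, mul_assoc] at h1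
  exact (mul_left_cancel₀ hx0 h1).symm

/-- **TRANSFORM LAW (b), along `O`, logarithmic derivations.** Same data; if `D 𝔪_S ⊆ 𝔪_S` then `D` itself extends
(`BlowupDerivation.exists_derivation_localBlowupAlong`) and `D F = x ^ N · D₁ f'`. OURS. [folklore] -/
theorem exists_derivation_eq_pow_mul_of_log_along {O : ValuationSubring K} {S S' : Subring K}
    [IsRegularLocalRing S] [IsLocalRing S'] (hA : IsQuadraticTransformAlong O S S')
    (hle : S ≤ S') (x : S') (F : S) (f' : S') (N : ℕ) (hN : (N : S') = 0)
    (hrel : f' * x ^ N = Subring.inclusion hle F) (D : Derivation ℤ S S)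
    (hlog : ∀ y ∈ maximalIdeal S, D y ∈ maximalIdeal S) :
    ∃ D₁ : Derivation ℤ S' S', Subring.inclusion hle (D F) = x ^ N * D₁ f' := by
  obtain ⟨_, hLB⟩ := id hA
  obtain ⟨D₁, hD₁⟩ := BlowupDerivation.exists_derivation_localBlowupAlong O S S' (maximalIdeal S) hLB D hlog
  refine ⟨D₁, ?_⟩
  have hDF : D₁ (Subring.inclusion hle F) = Subring.inclusion hle (D F) := hD₁ F
  rw [← derivation_mul_pow_of_cast_eq_zero D₁ f' x N hN, hrel, hDF]

/-! ## §3 The near-point order bound in the `Subring` currency -/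

/-- A ring isomorphism of local rings identifies the powers of the maximal ideals. [folklore] -/
theorem mem_maximalIdeal_pow_iff_of_ringEquiv {A B : Type*} [CommRing A] [CommRing B] [IsLocalRing A] [IsLocalRing B]
    (e : A ≃+* B) (a : A) (n : ℕ) : e a ∈ maximalIdeal B ^ n ↔ a ∈ maximalIdeal A ^ n := by
  constructor
  · intro h
    have h' := Ideal.mem_map_of_mem e.symm h
    rw [Ideal.map_pow, map_ringEquiv_maximalIdeal, RingEquiv.symm_apply_apply] at h'
    exact h'
  · intro h
    have h' := Ideal.mem_map_of_mem e h
    rw [Ideal.map_pow, map_ringEquiv_maximalIdeal] at h'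
    exact h'

/-- **NEAR-POINT ORDER BOUND, `Subring` currency** (Cossart–Piltant 2008, proof of Prop. 4.2, (11) and (a), for the blowing
up of the closed point): let `S ⊆ K` be a regular local subring dominated by the valuation ring `O`, `x₀ ∈ 𝔪_S` a non-zero
element of minimal value, and `S' = (S[𝔪/x₀])_{𝔪_O ∩ S[𝔪/x₀]}` the quadratic transform along `O`. For `h ∈ 𝔪^ν ∖ 𝔪^(ν+1)`
the weak transform `w = h / x₀ ^ ν` lies in `S'` and `w ∉ 𝔪_{S'}^(ν+1)`. Proof: the tree's chart theorem
`exists_weakTransform_chart_not_mem_pow` on `(S[𝔪t])_{(x₀t)}` at the centre `N` of `O`, read in `S'` through the isomorphism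
`θ_L : (S[𝔪t])_{(x₀t),N} ≅ S'` (`locToField`, injective with range `S'`). [cite: CossartPiltant2008, proof of Prop. 4.2, (11) and (a)] -/
theorem exists_div_pow_not_mem_pow_succ {O : ValuationSubring K} {S S' : Subring K}
    [IsRegularLocalRing S] [IsLocalRing S'] (hdom : SubringDominates S O.toSubring)
    {x₀ : S} (hx₀m : x₀ ∈ maximalIdeal S) (hx₀0 : x₀ ≠ 0)
    (hmin : ∀ y ∈ maximalIdeal S, O.valuation (y : K) ≤ O.valuation (x₀ : K))
    (hS' : S' = locAtCentre (blowupRing S (x₀ : K)) O)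
    {h : S} {ν : ℕ} (hν : h ∈ maximalIdeal S ^ ν) (hν' : h ∉ maximalIdeal S ^ (ν + 1)) :
    ∃ w : S', (w : K) * (x₀ : K) ^ ν = (h : K) ∧ w ∉ maximalIdeal S' ^ (ν + 1) := by
  classical
  have hx₀K : (x₀ : K) ≠ 0 := fun e => hx₀0 (Subtype.ext e)
  have hx₀2 : x₀ ∉ maximalIdeal S ^ 2 := QuadraticStep.not_mem_sq_of_forall_valuation_le hdom hx₀K hmin
  -- a regular system of parameters through `x₀`
  obtain ⟨e, c, hd, hc, hc0⟩ := (LowMult.isRsopPart_one_of_not_mem_sq hx₀m hx₀2).exists_rsop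
  have hci : c (Fin.castAdd e 0) = x₀ := hc0 0
  set i : Fin (1 + e) := Fin.castAdd e 0 with hi
  -- chart data
  have hθ : S.subtype (c i) ≠ 0 := by rw [hci]; exact hx₀K
  have hRO : ∀ r : S, S.subtype r ∈ O := fun r => hdom.1 r.2
  have hdom' : ∀ r ∈ maximalIdeal S, O.valuation (S.subtype r) < 1 := fun r hr =>
    ((subringDominates_valuationSubring_iff hdom.1).mp hdom r).mp hr
  have hmin' : ∀ j, O.valuation (S.subtype (c j)) ≤ O.valuation (S.subtype (c i)) := fun j => by
    rw [hci]
    exact hmin _ (hc ▸ Ideal.subset_span ⟨j, rfl⟩)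
  set N := chartCentre c i S.subtype hθ O hRO hmin' with hN
  have hNi : chartBase c i (c i) ∈ N := by
    rw [hN, mem_chartCentre_iff, chartToField_reesChartBase]
    exact hdom' _ (hci ▸ hx₀m)
  obtain ⟨f₁, hf₁, hnot⟩ := exists_weakTransform_chart_not_mem_pow hd c hc i hν hν' N hNi
  -- `θ_L : L ≅ S'`
  set φL := locToField c i S.subtype hθ O hRO hmin' (Localization.AtPrime N) with hφL
  have hinj : Function.Injective φL :=
    locToField_injective_rsopStep c i S.subtype hθ Subtype.val_injective O hRO hmin' _
  have hrange : φL.range = S' := by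
    rw [hS', hφL, range_locToField,
      range_chartToField_eq_blowupRing c i S.subtype hθ hc S (Subring.range_subtype S)]
    simp [hci]
  obtain ⟨eqv, heqv⟩ := exists_ringEquiv_of_range_eq_rsopStep φL hinj S' hrange
  refine ⟨eqv ((algebraMap (chartRing c i) (Localization.AtPrime N) :
      chartRing c i →+* Localization.AtPrime N) f₁), ?_, fun hmem => hnot ?_⟩
  · -- the value in `K`
    have h3 : (chartBase c i) (c i) ^ ν = (chartBase c i) (c i ^ ν) := (map_pow (chartBase c i) (c i) ν).symm
    rw [h3] at hf₁
    have h1 := congrArg (chartToField c i S.subtype hθ) hf₁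
    rw [map_mul, chartToField_reesChartBase, chartToField_reesChartBase] at h1
    have h4 : S.subtype (c i ^ ν) = (x₀ : K) ^ ν := by
      rw [hci]
      rfl
    rw [h4] at h1
    rw [heqv, hφL, locToField_algebraMap, mul_comm]
    exact h1.symm
  · exact (mem_maximalIdeal_pow_iff_of_ringEquiv eqv _ _).mp hmem

/-! ## §4 (B2) at the level of one step: the Jacobian order does not increase -/

/-- Units do not change membership in an ideal: `a = v · w` with `v` a unit and `w ∉ I` gives `a ∉ I`. [folklore] -/
theorem not_mem_of_eq_unit_mul {A : Type*} [CommRing A] {I : Ideal A} {v w a : A} (hv : IsUnit v)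
    (h : a = v * w) (hw : w ∉ I) : a ∉ I := by
  intro ha
  apply hw
  obtain ⟨v, rfl⟩ := hv
  have : w = ↑v⁻¹ * a := by rw [h, ← mul_assoc, Units.inv_mul, one_mul]
  rw [this]
  exact I.mul_mem_left _ ha

/-- **(B2), STEP FORM — the Jacobian order does not increase along one step of a stripped radicand chain.**
K♭ step binders (`NoEternalStrippedRadicandChain`): `S ≤ S'` subrings of a field, `S` regular local, `S'` a quadratic
transform of `S` (`IsQuadraticTransform`), `x ∈ S'` with `𝔪_S · S' = (x)`, radicand law `f' · x ^ N = F` with `F ∈ S`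
(`F = f − g ^ p`, `N = p · e`, so `(N : S') = 0`). If some `D ∈ Der_ℤ(S)` has `D F` of `𝔪_S`-adic order EXACTLY `ν` and
EITHER `N = ν + 1` (the full strip at the Jacobian order — strat-2's (B1), forced by isolatedness) OR `N = ν` and `D` is
`𝔪_S`-logarithmic (the coefficient-derivation mechanism of imperfect residue fields), then some `D₁ ∈ Der_ℤ(S')` has
`D₁ f' ∉ 𝔪_{S'} ^ (ν + 1)`: with `δ(f) := ord_𝔪 (D f)_D` (cleaning-invariant by `derivation_sub_pow_char`), `δ(f') ≤ ν`.
Proof: §2 gives `D₁ f' = unit · (D F) / x₀ ^ ν` and §3 says `(D F) / x₀ ^ ν ∉ 𝔪_{S'} ^ (ν+1)`. Excellence, dimension and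
isolatedness binders of K♭ are not used. OURS. [cite: CossartPiltant2008, proof of Prop. 4.2, (11) and (a)] [folklore] -/
theorem exists_derivation_apply_not_mem_pow_succ {S S' : Subring K} [IsRegularLocalRing S] [IsLocalRing S']
    (hQT : IsQuadraticTransform S S') (hle : S ≤ S') (x : S')
    (hspan : Ideal.span ((Subring.inclusion hle) '' (maximalIdeal S : Set S)) = Ideal.span {x})
    (F : S) (f' : S') (N : ℕ) (hN : (N : S') = 0) (hrel : f' * x ^ N = Subring.inclusion hle F)
    (D : Derivation ℤ S S) (ν : ℕ) (hν : D F ∈ maximalIdeal S ^ ν) (hν' : D F ∉ maximalIdeal S ^ (ν + 1))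
    (hcase : N = ν + 1 ∨ (N = ν ∧ ∀ y ∈ maximalIdeal S, D y ∈ maximalIdeal S)) :
    ∃ D₁ : Derivation ℤ S' S', D₁ f' ∉ maximalIdeal S' ^ (ν + 1) := by
  obtain ⟨O, hA, hdom, -⟩ := exists_along S S' hQT
  obtain ⟨_, x₀, hx₀m, hx₀0, hmin, hS'⟩ := hA.exists_eq_locAtCentre
  have hx₀K : (x₀ : K) ≠ 0 := fun e => hx₀0 (Subtype.ext e)
  obtain ⟨u, hu, hux⟩ := exists_isUnit_eq_mul hle hx₀m hx₀K hS' x hspan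
  obtain ⟨w, hw, hwn⟩ := exists_div_pow_not_mem_pow_succ hdom hx₀m hx₀0 hmin hS' hν hν'
  -- `D F = w · (u x) ^ ν` in `S'`
  have hwS : Subring.inclusion hle (D F) = w * (u * x) ^ ν := by
    apply Subtype.ext
    rw [← hux]
    change ((D F : S) : K) = (w : K) * ((x₀ : K)) ^ ν
    exact hw.symm
  have hx0 : x ≠ 0 := by
    intro h0
    apply hx₀0
    have : (Subring.inclusion hle x₀ : S') = 0 := by rw [hux, h0, mul_zero]
    exact Subring.inclusion_injective hle (by rw [this, map_zero])
  have hxν : x ^ ν ≠ 0 := pow_ne_zero ν hx0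
  rcases hcase with hN1 | ⟨hN0, hlog⟩
  · -- full strip: `D₁` extends `x₀ · D`, `u' · D F = x ^ ν · D₁ f'`
    obtain ⟨D₁, u', hu', h1⟩ :=
      exists_derivation_unit_mul_eq_pow_mul_along hA hle x hspan F f' N (by omega) hN hrel D
    rw [hN1, Nat.add_sub_cancel, hwS] at h1
    have h2 : x ^ ν * D₁ f' = x ^ ν * ((u' * u ^ ν) * w) := by rw [← h1]; ring
    exact ⟨D₁, not_mem_of_eq_unit_mul (hu'.mul (hu.pow ν)) (mul_left_cancel₀ hxν h2) hwn⟩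
  · -- logarithmic `D`: `D₁` extends `D`, `D F = x ^ ν · D₁ f'`
    subst hN0
    obtain ⟨D₁, h1⟩ := exists_derivation_eq_pow_mul_of_log_along hA hle x F f' N hN hrel D hlog
    rw [hwS] at h1
    have h2 : x ^ N * D₁ f' = x ^ N * (u ^ N * w) := by rw [← h1]; ring
    exact ⟨D₁, not_mem_of_eq_unit_mul (hu.pow N) (mul_left_cancel₀ hxν h2) hwn⟩

/-- **(B2) over the VERBATIM K♭ step binders** (`NoEternalStrippedRadicandChain p c`, one index `m`): members `f ∈ S`,
`f' ∈ S'`, cleaner `g ∈ S`, exceptional parameter `x ∈ S'` with `𝔪_S · S' = (x)`, free stripping exponent `e`, law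
`f' · x ^ (p e) = f − g ^ p` in the field, `CharP L p`. If some `D ∈ Der_ℤ(S)` has `D f` (NOT `D (f − g^p)`: cleaning
invariance) of exact `𝔪_S`-order `ν`, and `p e = ν + 1` or (`p e = ν` and `D` logarithmic), then some `D₁ ∈ Der_ℤ(S')` has
`D₁ f' ∉ 𝔪_{S'} ^ (ν+1)`. OURS. [cite: CossartPiltant2008, proof of Prop. 4.2, (11) and (a)] [folklore] -/
theorem exists_derivation_apply_not_mem_pow_succ_of_law (p : ℕ) [CharP K p] {S S' : Subring K}
    [IsRegularLocalRing S] [IsLocalRing S'] (hQT : IsQuadraticTransform S S') (hle : S ≤ S')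
    (f g : S) (f' x : S') (e : ℕ)
    (hspan : Ideal.span ((fun y : S => (⟨(y : K), hle y.2⟩ : S')) '' (maximalIdeal S : Set S)) = Ideal.span {x})
    (hrel : (f' : K) * (x : K) ^ (p * e) = (f : K) - (g : K) ^ p)
    (D : Derivation ℤ S S) (ν : ℕ) (hν : D f ∈ maximalIdeal S ^ ν) (hν' : D f ∉ maximalIdeal S ^ (ν + 1))
    (hcase : p * e = ν + 1 ∨ (p * e = ν ∧ ∀ y ∈ maximalIdeal S, D y ∈ maximalIdeal S)) :
    ∃ D₁ : Derivation ℤ S' S', D₁ f' ∉ maximalIdeal S' ^ (ν + 1) := by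
  have hpK : (p : K) = 0 := CharP.cast_eq_zero K p
  have hpS : (p : S) = 0 := Subtype.ext (by push_cast; exact hpK)
  have hN : ((p * e : ℕ) : S') = 0 := Subtype.ext (by push_cast; rw [hpK, zero_mul])
  have hDF : D (f - g ^ p) = D f := derivation_sub_pow_char p hpS D f g
  have hrel' : f' * x ^ (p * e) = Subring.inclusion hle (f - g ^ p) := Subtype.ext (by
    rw [map_sub, map_pow]
    push_cast
    exact hrel)
  rw [← hDF] at hν hν'
  exact exists_derivation_apply_not_mem_pow_succ hQT hle x hspan (f - g ^ p) f' (p * e) hN hrel' D ν hν hν' hcase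

end CleanedOrderMonotone

end Summit.ResolutionOfSingularities.ResolutionOfSingularities.Theorems.SwitchingDichotomy

end
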